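import Mathlib
import HarnessLib
import Summits.ValiantsHypothesis.ValiantsHypothesis.Theses.ValuativeGCT
import Literature.NumberTheory.DiophantineGeometry.SchurWeylPlethysmOrbitWeightsProofs
import Literature.NumberTheory.DiophantineGeometry.TensorWordModel
import Summits.ValiantsHypothesis.ValiantsHypothesis.Theorems.ValuativeGCTValuativeFlipGradedFloor
import Summits.ValiantsHypothesis.ValiantsHypothesis.Theorems.ValuativeGCTValuativeFlipHwvMul
import Summits.ValiantsHypothesis.ValiantsHypothesis.Theorems.ValuativeGCTValuativeFlipTruncMul

/-!
# Line `big-cell-semigroup-floor` — checked skeleton for crux `ValuativeGCT.ValuativeFlip`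
(stmt-ValiantsHypothesis-12624; idea card `Cruxes/ValuativeFlip/Ideas/big-cell-semigroup-floor.md`,
line card `Cruxes/ValuativeFlip/Lines/big-cell-semigroup-floor.md` — planner verdict `no-skeleton`;
rebuilt by the fourth line lead prover-line-stmt-ValiantsHypothesis-12624-a1-0, 2026-08-16, from the
line card §2 because the planner's attempted `.lean` is item evidence only.)

THE LINE.  Certify the PER side of the flip by SEMIGROUP GROWTH: `D + 1` algebraically independent
highest-weight vectors of one weight `ν` in the coordinate ring of an orbit closure give
`mult(k • ν) ≥ C(k + D, D)` for every `k` (products of highest-weight vectors are highest-weight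
vectors of the summed weight, monomials in algebraically independent elements are linearly
independent).  Run on `ℂ[Δ_m(X₀₀^{m-n} per_n)]` with a rich seed family (`stub_seedRichness`, the
per-side content), this is a per-side lower-bound ENGINE in the det side's currency; the line then
asks the route's DET side — the valuative truncation `T_U` of the crux, verbatim — to stay below the
binomial count at some multiple `k • ν` (`stub_detCensus`, the hardest stub).

THE CUT (≤ 7 stubs; sorries only in `stub_*`):
* `stub_gradedFloor`  — abstract algebra: a multiplicative ℕ-filtration `S` of a commutative
  ℂ-algebra with `1 ∈ S 0`, `S a · S b ⊆ S (a+b)` and `D+1` algebraically independent elements in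
  `S 1` has `dim S k ≥ C(k+D, D)`.  PROVABLE (S/M).
* `stub_hwvMul`       — products of highest-weight vectors in `ℂ[Δ_m(f)]` (`orbitCoordRep` acts by
  algebra automorphisms; `weightChar_add`).  PROVABLE (S).
* `stub_truncMul`     — the det-side mirror: the valuative truncation is multiplicative,
  `T_U(D₁,t₁,χ₁) · T_U(D₂,t₂,χ₂) ⊆ T_U(D₁+D₂, t₁+t₂, χ₁+χ₂)` (degrees add, `P_U^{t₁} P_U^{t₂} ⊆ P_U^{t₁+t₂}`,
  `aeval` is a ring map, `weightChar_add`).  PROVABLE (M).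
* `stub_seedRichness` — per side: for all large `n` and every `m ≥ n`, `ℂ[Δ_m(X₀₀^{m-n} per_n)]` has
  `D + 1 > n⁴/4` algebraically independent highest-weight vectors of one weight.  OPEN /
  computational (intended source: `m`-free seeds of `per_n` transported by the Kadish–Landsberg/BIP
  lift — algebraic independence, unlike multiplicity (BLMW Problem 6.10), is inherited upward).
* `stub_detCensus`    — det side, HARDEST: for every such seed weight `ν` and richness `D` some
  admissible centre `(U, r)` and some multiple `λ* = k • ν` have `dim T_U(λ) < C(k+D, D)`.  OPEN —
  and neutralised by `census_forces_dependence` below (formal matching, the line card §3).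

GLUE (sorry-free): `semigroupFloor` (= gradedFloor + hwvMul + the weight-pins-degree fact) is the
engine; `ValuativeFlip_of : ValuativeFlip` concludes the crux BY NAME from seedRichness + detCensus +
semigroupFloor; `matching_floor` / `census_forces_dependence` (= gradedFloor + truncMul) is the
det-side mirror that kills the census: a census below `C(k+D, D)` at ANY admissible `(U, r)` forces
every `D+1` elements of the seed truncation `T_U(Dg, t, ν)` — in particular the pulled-back lifted
per seeds, which lie there for every admissible `(U, r)` by the `ValuativeBound` mechanism
(`OrbitMapKernel`, `CoeffVanishingOrder`) — to be algebraically DEPENDENT in the polynomial ring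
`ℂ[End W]`; such a dependence is a separating equation on its own (line card §3(a)), so the engine,
the valuation and the census are never load-bearing.
-/

set_option linter.dupNamespace false

namespace Summit.ValiantsHypothesis.ValiantsHypothesis.Cruxes.ValuativeFlip.BigCellSemigroupFloor

open scoped BigOperators Matrix
open Literature.NumberTheory.DiophantineGeometry Literature.Computability.AlgebraicComplexity

noncomputable section

/-! ## Stub 1 — the abstract semigroup floor (provable) -/

/-- **stub_gradedFloor** — SEMIGROUP FLOOR, abstract form.  In a commutative `ℂ`-algebra `R`, let
`S : ℕ → Submodule ℂ R` be multiplicative (`1 ∈ S 0`, `S a * S b ≤ S (a + b)`).  If `S 1` contains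
`D + 1` algebraically independent elements `F₀, …, F_D`, then for every `k` the degree-`k` monomials
`∏ F_i^{e_i}` (`Σ e_i = k`; there are `C(k + D, D)` of them) lie in `S k` and are linearly independent
(algebraic independence = injectivity of `MvPolynomial.aeval F`, and distinct monomials of
`MvPolynomial (Fin (D+1)) ℂ` are linearly independent), so `C(k + D, D) ≤ dim S k` whenever `S k` is
finite-dimensional.  Size S/M.  [folklore: Hilbert function of a polynomial subalgebra;
Kaveh–Khovanskii, Ann. Math. 176 (2012) §1 for the semigroup point of view] -/
theorem stub_gradedFloor :
    ∀ {R : Type} [CommRing R] [Algebra ℂ R] (S : ℕ → Submodule ℂ R),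
      (1 : R) ∈ S 0 → (∀ a b : ℕ, S a * S b ≤ S (a + b)) →
      ∀ (D : ℕ) (F : Fin (D + 1) → R), (∀ i, F i ∈ S 1) → AlgebraicIndependent ℂ F →
      ∀ k : ℕ, FiniteDimensional ℂ ↥(S k) → (k + D).choose D ≤ Module.finrank ℂ ↥(S k) := by
  -- LANDED (wave 1, p96543): `Theorems/ValuativeGCTValuativeFlipGradedFloor.lean`
  intro R _ _ S h1 hmul D F hF hind k hfin
  exact _root_.Summit.ValiantsHypothesis.ValiantsHypothesis.Theorems.ValuativeFlip.stub_gradedFloor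
    S h1 hmul D F hF hind k hfin

/-! ## Stub 2 — products of highest-weight vectors in an orbit-closure coordinate ring (provable) -/

/-- **stub_hwvMul** — MULTIPLICATIVITY OF HIGHEST-WEIGHT VECTORS (idea card, first lemma
`HWVProduct`, without the non-vanishing clause).  In the coordinate ring `ℂ[Δ_m(f)] = OrbitCoordRing f m`
of the orbit closure of any form `f`, the group `GL σ ℂ` acts through ALGEBRA automorphisms
(`orbitCoordRep_apply`, `orbitCoordSubst : _ →ₐ[ℂ] _`), so for `B`-semi-invariants `x, y` of weights
`χ₁, χ₂`: `g · (x y) = (g · x)(g · y) = χ₁(g) χ₂(g) · x y = (χ₁ + χ₂)(g) · x y` (`weightChar_add`, the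
diagonal of an upper-triangular invertible `g` being nonzero).  Size S.
[Fulton–Harris §15.3; BLMW 2011 §5.2; folklore] -/
theorem stub_hwvMul :
    ∀ {σ : Type} [Fintype σ] [LinearOrder σ] (f : MvPolynomial σ ℂ) (m : ℕ) (χ₁ χ₂ : Weight σ)
      (x y : OrbitCoordRing f m),
      x ∈ highestWeightSpace (orbitCoordRep f m) χ₁ → y ∈ highestWeightSpace (orbitCoordRep f m) χ₂ →
      x * y ∈ highestWeightSpace (orbitCoordRep f m) (χ₁ + χ₂) := by
  -- LANDED (wave 1, p96740): `Theorems/ValuativeGCTValuativeFlipHwvMul.lean`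
  intro σ _ _ f m χ₁ χ₂ x y hx hy
  exact _root_.Summit.ValiantsHypothesis.ValiantsHypothesis.Theorems.ValuativeFlip.stub_hwvMul
    f m χ₁ χ₂ x y hx hy

/-! ## Stub 3 — the valuative truncation is multiplicative (det side, provable) -/

/-- **stub_truncMul** — MULTIPLICATIVITY OF THE VALUATIVE TRUNCATION (line card §3.1, the det-side
mirror of the engine; triage r1-1 "HOPF" at the level of elements).  Write `T_U(Dg, t, χ)` for the
crux's truncation with free degree `Dg`, threshold `t` and weight `χ` (the crux has `Dg = mδ`,
`t = δ(m - r)`, `χ = λ*`).  Then `G₁ ∈ T_U(D₁, t₁, χ₁)`, `G₂ ∈ T_U(D₂, t₂, χ₂)` imply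
`G₁ G₂ ∈ T_U(D₁ + D₂, t₁ + t₂, χ₁ + χ₂)`: homogeneous degrees add (`IsHomogeneous.mul`); `P^{t₁} P^{t₂} ≤ P^{t₁+t₂}`
(`Ideal.mul_mem_mul`, `pow_add`); each `σ_M = aeval (…)` is a ring map, so `σ_M(G₁G₂) = G₁G₂`; each
`ρ_g = aeval (…)` is a ring map and `weightChar (χ₁ + χ₂) g = weightChar χ₁ g * weightChar χ₂ g` for
upper-triangular `g` (`weightChar_add`).  Size M (bookkeeping in the four-fold intersection).
[this line; folklore] -/
theorem stub_truncMul :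
    ∀ (m : ℕ) (U : Submodule ℂ (MatIdx m → ℂ)) (D₁ D₂ t₁ t₂ : ℕ) (χ₁ χ₂ : Weight (MatIdx m))
      (G₁ G₂ : MvPolynomial (MatIdx m × MatIdx m) ℂ),
      G₁ ∈ MvPolynomial.homogeneousSubmodule (MatIdx m × MatIdx m) ℂ D₁ ⊓
          ((MvPolynomial.vanishingIdeal ℂ
              {p : MatIdx m × MatIdx m → ℂ | ∀ j : MatIdx m, (fun i => p (j, i)) ∈ U}) ^ t₁).restrictScalars ℂ ⊓
          (⨅ (M : Matrix (MatIdx m) (MatIdx m) ℂ)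
            (_ : linSubst (MatIdx m) ℂ M (detFormLex ℂ m) = detFormLex ℂ m),
            LinearMap.ker ((MvPolynomial.aeval fun p : MatIdx m × MatIdx m =>
                ∑ l : MatIdx m, M l p.2 •
                  (MvPolynomial.X (p.1, l) : MvPolynomial (MatIdx m × MatIdx m) ℂ)).toLinearMap -
              (LinearMap.id : MvPolynomial (MatIdx m × MatIdx m) ℂ →ₗ[ℂ] MvPolynomial (MatIdx m × MatIdx m) ℂ))) ⊓
          (⨅ (g : Matrix.GeneralLinearGroup (MatIdx m) ℂ) (_ : IsUpperTriangular g),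
            LinearMap.ker ((MvPolynomial.aeval fun p : MatIdx m × MatIdx m =>
                ∑ l : MatIdx m, ((g⁻¹ : Matrix.GeneralLinearGroup (MatIdx m) ℂ) :
                  Matrix (MatIdx m) (MatIdx m) ℂ) p.1 l •
                    (MvPolynomial.X (l, p.2) : MvPolynomial (MatIdx m × MatIdx m) ℂ)).toLinearMap -
              weightChar χ₁ g •
                (LinearMap.id : MvPolynomial (MatIdx m × MatIdx m) ℂ →ₗ[ℂ] MvPolynomial (MatIdx m × MatIdx m) ℂ))) →
      G₂ ∈ MvPolynomial.homogeneousSubmodule (MatIdx m × MatIdx m) ℂ D₂ ⊓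
          ((MvPolynomial.vanishingIdeal ℂ
              {p : MatIdx m × MatIdx m → ℂ | ∀ j : MatIdx m, (fun i => p (j, i)) ∈ U}) ^ t₂).restrictScalars ℂ ⊓
          (⨅ (M : Matrix (MatIdx m) (MatIdx m) ℂ)
            (_ : linSubst (MatIdx m) ℂ M (detFormLex ℂ m) = detFormLex ℂ m),
            LinearMap.ker ((MvPolynomial.aeval fun p : MatIdx m × MatIdx m =>
                ∑ l : MatIdx m, M l p.2 •
                  (MvPolynomial.X (p.1, l) : MvPolynomial (MatIdx m × MatIdx m) ℂ)).toLinearMap -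
              (LinearMap.id : MvPolynomial (MatIdx m × MatIdx m) ℂ →ₗ[ℂ] MvPolynomial (MatIdx m × MatIdx m) ℂ))) ⊓
          (⨅ (g : Matrix.GeneralLinearGroup (MatIdx m) ℂ) (_ : IsUpperTriangular g),
            LinearMap.ker ((MvPolynomial.aeval fun p : MatIdx m × MatIdx m =>
                ∑ l : MatIdx m, ((g⁻¹ : Matrix.GeneralLinearGroup (MatIdx m) ℂ) :
                  Matrix (MatIdx m) (MatIdx m) ℂ) p.1 l •
                    (MvPolynomial.X (l, p.2) : MvPolynomial (MatIdx m × MatIdx m) ℂ)).toLinearMap -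
              weightChar χ₂ g •
                (LinearMap.id : MvPolynomial (MatIdx m × MatIdx m) ℂ →ₗ[ℂ] MvPolynomial (MatIdx m × MatIdx m) ℂ))) →
      G₁ * G₂ ∈ MvPolynomial.homogeneousSubmodule (MatIdx m × MatIdx m) ℂ (D₁ + D₂) ⊓
          ((MvPolynomial.vanishingIdeal ℂ
              {p : MatIdx m × MatIdx m → ℂ | ∀ j : MatIdx m, (fun i => p (j, i)) ∈ U}) ^ (t₁ + t₂)).restrictScalars ℂ ⊓
          (⨅ (M : Matrix (MatIdx m) (MatIdx m) ℂ)
            (_ : linSubst (MatIdx m) ℂ M (detFormLex ℂ m) = detFormLex ℂ m),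
            LinearMap.ker ((MvPolynomial.aeval fun p : MatIdx m × MatIdx m =>
                ∑ l : MatIdx m, M l p.2 •
                  (MvPolynomial.X (p.1, l) : MvPolynomial (MatIdx m × MatIdx m) ℂ)).toLinearMap -
              (LinearMap.id : MvPolynomial (MatIdx m × MatIdx m) ℂ →ₗ[ℂ] MvPolynomial (MatIdx m × MatIdx m) ℂ))) ⊓
          (⨅ (g : Matrix.GeneralLinearGroup (MatIdx m) ℂ) (_ : IsUpperTriangular g),
            LinearMap.ker ((MvPolynomial.aeval fun p : MatIdx m × MatIdx m =>
                ∑ l : MatIdx m, ((g⁻¹ : Matrix.GeneralLinearGroup (MatIdx m) ℂ) :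
                  Matrix (MatIdx m) (MatIdx m) ℂ) p.1 l •
                    (MvPolynomial.X (l, p.2) : MvPolynomial (MatIdx m × MatIdx m) ℂ)).toLinearMap -
              weightChar (χ₁ + χ₂) g •
                (LinearMap.id : MvPolynomial (MatIdx m × MatIdx m) ℂ →ₗ[ℂ] MvPolynomial (MatIdx m × MatIdx m) ℂ))) := by
  -- LANDED (wave 1, p97060): `Theorems/ValuativeGCTValuativeFlipTruncMul.lean`
  intro m U D₁ D₂ t₁ t₂ χ₁ χ₂ G₁ G₂ h₁ h₂
  exact _root_.Summit.ValiantsHypothesis.ValiantsHypothesis.Theorems.ValuativeFlip.stub_truncMul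
    m U D₁ D₂ t₁ t₂ χ₁ χ₂ G₁ G₂ h₁ h₂

/-! ## Stub 4 — seed richness (per side, open / computational) -/

/-- **stub_seedRichness** — RICH SEED FAMILIES ON THE PADDED PERMANENT (the per-side content of the
line; idea card "Cheapest falsifier", line card §2 `stub_seedRichness`, here stated at every size
`m ≥ n` directly, so that no single-orbit-closure inheritance of MULTIPLICITIES (BLMW 2011 Problem
6.10, the death of line per-anchor-catch-up) is ever needed).  For all large `n` and every `m ≥ n`
the coordinate ring `ℂ[Δ_m(X₀₀^{m-n} per_n)]` (`orbitCoordRep (paddedPerFormLex ℂ n m) m`) contains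
`D + 1` ALGEBRAICALLY INDEPENDENT highest-weight vectors of one common weight `ν`, with `D ≥ n⁴/4`.
Why plausible: the intended seeds are `m`-free — leading-exponent sets of highest-weight vectors of
`ℂ[Δ_n(per_n)]` at small weights (Krull dimension of a weight-ray subalgebra `≈ n⁴/2`), transported
to size `m` by the Kadish–Landsberg / BIP lift `liftHWV` (tree), which is an ALGEBRA map sending
`HWV_{μ*}` to `HWV_{(μ♯m)*}` (`liftHWV_mem_highestWeightSpace`); algebraic independence modulo
`I(Δ_n per_n)` of the `Δ_j`-twisted seeds `f ↦ F(Δ_j f)` (`aeval_formCoeff_paddedForm_liftHWV`)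
passes to the lifts modulo `I(Δ_m(X₀₀^{m-n} per_n))` because the padded copies `X_top^{m-n}·f`,
`f ∈ Δ_n(per_n)`, lie in `Δ_m(X₀₀^{m-n} per_n)` — a dependence upstairs restricts to one downstairs
(the direction Problem 6.10 does NOT obstruct).  Status: OPEN (no seed computation has been run;
kit-sized at `n = 3`, `δ₀ ∈ {2, 3}`); `m`-dependent as typed.  Size L / computational. -/
theorem stub_seedRichness :
    ∃ n₁ : ℕ, ∀ n ≥ n₁, ∀ (m : ℕ) [NeZero m], n ≤ m →
      ∃ (ν : Weight (MatIdx m)) (D : ℕ) (F : Fin (D + 1) → OrbitCoordRing (paddedPerFormLex ℂ n m) m),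
        n ^ 4 / 4 ≤ D ∧
        (∀ i, F i ∈ highestWeightSpace (orbitCoordRep (paddedPerFormLex ℂ n m) m) ν) ∧
        AlgebraicIndependent ℂ F := by
  sorry

/-! ## Stub 5 — the det census below the binomial count (hardest, open; see `census_forces_dependence`) -/

/-- **stub_detCensus** — THE DET CENSUS (line card §2 `stub_detCensus`, the load-bearing stub of
any semigroup-floor composition; HARDEST; held by the lead).  For every `c`, all large `n`, every
`m` in the window `n ≤ m ≤ 2^((log₂ n + c)^c)`, and EVERY rich seed datum at size `m` — a weight `ν`
carrying `D + 1 > n⁴/4` algebraically independent highest-weight vectors of `ℂ[Δ_m(X₀₀^{m-n} per_n)]`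
— there are an admissible centre `(U, r)` (every `u ∈ U` of rank `≤ r`), a multiple `k`, a degree
`δ` and a partition `λ ⊢ mδ` with `≤ m²` parts and `λ* = k • ν`, such that the crux's valuative
truncation `T_U(λ)` (verbatim: degree `mδ`, threshold `δ(m - r)`, `Stab_End(det_m)`-invariant,
`B`-semi-invariant of weight `λ*`) has dimension `< C(k + D, D)`.  Status: OPEN, and by
`census_forces_dependence` (this file, sorry-free over stubs 1 and 3) equivalent to an
algebraic-independence DEFICIT of the seed truncation `T_U(·, ·, ν)` in the polynomial ring
`ℂ[End W]` — which contains the pulled-back lifted per seeds for every admissible `(U, r)`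
(`ValuativeBound` mechanism) — i.e. to a relation among seed covariants on `End(W_m) · det_m` that
fails on `Δ_m(X₀₀^{m-n} per_n)`: a separating equation by itself (line card §3(a)), expected to
contradict the secant dimension count for `m ≥ 1.5 n³ + 2n` inside the window (line card §3(b)). -/
theorem stub_detCensus :
    ∀ c : ℕ, ∃ n₀ : ℕ, ∀ n ≥ n₀, ∀ (m : ℕ) [NeZero m], n ≤ m → m ≤ 2 ^ ((Nat.log 2 n + c) ^ c) →
      ∀ (ν : Weight (MatIdx m)) (D : ℕ), n ^ 4 / 4 ≤ D →
        (∃ F : Fin (D + 1) → OrbitCoordRing (paddedPerFormLex ℂ n m) m,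
          (∀ i, F i ∈ highestWeightSpace (orbitCoordRep (paddedPerFormLex ℂ n m) m) ν) ∧
          AlgebraicIndependent ℂ F) →
        ∃ (U : Submodule ℂ (MatIdx m → ℂ)) (r k δ : ℕ) (lam : Nat.Partition (m * δ)),
          (∀ u ∈ U, (Matrix.of fun a b : Fin m => u (toLex (a, b))).rank ≤ r) ∧
          lam.parts.card ≤ m * m ∧
          ((Weight.dualOfPartition (m * m) lam).toMatIdx : Weight (MatIdx m)) = k • ν ∧
          Module.finrank ℂ ↥(MvPolynomial.homogeneousSubmodule (MatIdx m × MatIdx m) ℂ (m * δ) ⊓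
              ((MvPolynomial.vanishingIdeal ℂ
                  {p : MatIdx m × MatIdx m → ℂ | ∀ j : MatIdx m, (fun i => p (j, i)) ∈ U}) ^ (δ * (m - r))).restrictScalars ℂ ⊓
              (⨅ (M : Matrix (MatIdx m) (MatIdx m) ℂ)
                (_ : linSubst (MatIdx m) ℂ M (detFormLex ℂ m) = detFormLex ℂ m),
                LinearMap.ker ((MvPolynomial.aeval fun p : MatIdx m × MatIdx m =>
                    ∑ l : MatIdx m, M l p.2 •
                      (MvPolynomial.X (p.1, l) : MvPolynomial (MatIdx m × MatIdx m) ℂ)).toLinearMap -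
                  (LinearMap.id : MvPolynomial (MatIdx m × MatIdx m) ℂ →ₗ[ℂ] MvPolynomial (MatIdx m × MatIdx m) ℂ))) ⊓
              (⨅ (g : Matrix.GeneralLinearGroup (MatIdx m) ℂ) (_ : IsUpperTriangular g),
                LinearMap.ker ((MvPolynomial.aeval fun p : MatIdx m × MatIdx m =>
                    ∑ l : MatIdx m, ((g⁻¹ : Matrix.GeneralLinearGroup (MatIdx m) ℂ) :
                      Matrix (MatIdx m) (MatIdx m) ℂ) p.1 l •
                        (MvPolynomial.X (l, p.2) : MvPolynomial (MatIdx m × MatIdx m) ℂ)).toLinearMap -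
                  weightChar ((Weight.dualOfPartition (m * m) lam).toMatIdx : Weight (MatIdx m)) g •
                    (LinearMap.id : MvPolynomial (MatIdx m × MatIdx m) ℂ →ₗ[ℂ] MvPolynomial (MatIdx m × MatIdx m) ℂ)))) <
            (k + D).choose D := by
  sorry

/-! ## Glue I — the per-side engine (sorry-free over stubs 1–2) -/

/-- `1` is a highest-weight vector of weight `0` in any orbit-closure coordinate ring. [folklore] -/
theorem one_mem_highestWeightSpace_zero {σ : Type} [Fintype σ] [LinearOrder σ]
    (f : MvPolynomial σ ℂ) (m : ℕ) :
    (1 : OrbitCoordRing f m) ∈ highestWeightSpace (orbitCoordRep f m) (0 : Weight σ) := by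
  intro g _
  rw [orbitCoordRep_apply, map_one]
  simp [weightChar]

/-- **The semigroup floor** (the line's ENGINE, `stub_semigroupFloor` of the line card): in the
coordinate ring of the orbit closure of ANY form `f` of degree `m ≠ 0`, `D + 1` algebraically
independent highest-weight vectors of weight `χ` force `mult(k • χ) ≥ C(k + D, D)` for every `k`.
From `stub_gradedFloor` with `S a := HWV_{a • χ}` (multiplicative by `stub_hwvMul`, `add_nsmul`) and
the weight-pins-degree finiteness `finiteDimensional_highestWeightSpace_orbitCoordRep_holds`. -/
theorem semigroupFloor {σ : Type} [Fintype σ] [LinearOrder σ] (f : MvPolynomial σ ℂ) {m : ℕ}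
    (hm : m ≠ 0) (χ : Weight σ) (D : ℕ) (F : Fin (D + 1) → OrbitCoordRing f m)
    (hF : ∀ i, F i ∈ highestWeightSpace (orbitCoordRep f m) χ) (hind : AlgebraicIndependent ℂ F)
    (k : ℕ) : (k + D).choose D ≤ orbitMultiplicity ℂ f m (k • χ) := by
  set S : ℕ → Submodule ℂ (OrbitCoordRing f m) :=
    fun a => highestWeightSpace (orbitCoordRep f m) (a • χ) with hS
  have h1 : (1 : OrbitCoordRing f m) ∈ S 0 := by
    simp only [hS, zero_nsmul]
    exact one_mem_highestWeightSpace_zero f m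
  have hmul : ∀ a b : ℕ, S a * S b ≤ S (a + b) := by
    intro a b
    rw [Submodule.mul_le]
    intro x hx y hy
    have h := stub_hwvMul f m (a • χ) (b • χ) x y hx hy
    simp only [hS, add_nsmul]
    exact h
  have hF1 : ∀ i, F i ∈ S 1 := fun i => by
    simp only [hS, one_nsmul]
    exact hF i
  haveI : FiniteDimensional ℂ ↥(S k) :=
    finiteDimensional_highestWeightSpace_orbitCoordRep_holds (k := ℂ) f hm (k • χ)
  exact stub_gradedFloor S h1 hmul D F hF1 hind k inferInstance

/-! ## Glue II — the crux from the stubs (sorry-free over stubs 1, 2, 4, 5) -/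

/-- **Composition** — the crux `ValuativeGCT.ValuativeFlip` (the route decl, BY NAME) from
`stub_seedRichness`, `stub_detCensus` and the engine `semigroupFloor` (stubs 1–2):
`dim T_U(λ) < C(k + D, D) ≤ mult_{k • ν} ℂ[Δ_m(X₀₀^{m-n} per_n)] = mult_{λ*}`.  Bookkeeping only. -/
theorem ValuativeFlip_of :
    Summit.ValiantsHypothesis.ValiantsHypothesis.Theses.ValuativeGCT.ValuativeFlip := by
  have hSeed := stub_seedRichness
  have hCensus := stub_detCensus
  intro c
  obtain ⟨n₁, hn₁⟩ := hSeed
  obtain ⟨n₀, hn₀⟩ := hCensus c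
  refine ⟨max n₀ n₁, ?_⟩
  intro n hn m _ hnm hm
  have hn₀' : n₀ ≤ n := le_of_max_le_left hn
  have hn₁' : n₁ ≤ n := le_of_max_le_right hn
  obtain ⟨ν, D, F, hD, hF, hind⟩ := hn₁ n hn₁' m hnm
  obtain ⟨U, r, k, δ, lam, hU, hcard, hw, hlt⟩ :=
    hn₀ n hn₀' m hnm hm ν D hD ⟨F, hF, hind⟩
  refine ⟨U, r, δ, lam, hU, hcard, ?_⟩
  have hfloor := semigroupFloor (paddedPerFormLex ℂ n m) (NeZero.ne m) ν D F hF hind k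
  rw [← hw] at hfloor
  simp only []
  exact lt_of_lt_of_le hlt hfloor

/-! ## Glue III — formal matching: the det side inherits every floor (sorry-free over stubs 1, 3) -/

/-- `1 ∈ T_U(0, 0, 0)`: constants are homogeneous of degree `0`, lie in `P_U^0 = ⊤`, are fixed by
every substitution and have Borel weight `0`. [folklore] -/
theorem one_mem_trunc_zero (m : ℕ) (U : Submodule ℂ (MatIdx m → ℂ)) :
    (1 : MvPolynomial (MatIdx m × MatIdx m) ℂ) ∈
      MvPolynomial.homogeneousSubmodule (MatIdx m × MatIdx m) ℂ 0 ⊓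
          ((MvPolynomial.vanishingIdeal ℂ
              {p : MatIdx m × MatIdx m → ℂ | ∀ j : MatIdx m, (fun i => p (j, i)) ∈ U}) ^ 0).restrictScalars ℂ ⊓
          (⨅ (M : Matrix (MatIdx m) (MatIdx m) ℂ)
            (_ : linSubst (MatIdx m) ℂ M (detFormLex ℂ m) = detFormLex ℂ m),
            LinearMap.ker ((MvPolynomial.aeval fun p : MatIdx m × MatIdx m =>
                ∑ l : MatIdx m, M l p.2 •
                  (MvPolynomial.X (p.1, l) : MvPolynomial (MatIdx m × MatIdx m) ℂ)).toLinearMap -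
              (LinearMap.id : MvPolynomial (MatIdx m × MatIdx m) ℂ →ₗ[ℂ] MvPolynomial (MatIdx m × MatIdx m) ℂ))) ⊓
          (⨅ (g : Matrix.GeneralLinearGroup (MatIdx m) ℂ) (_ : IsUpperTriangular g),
            LinearMap.ker ((MvPolynomial.aeval fun p : MatIdx m × MatIdx m =>
                ∑ l : MatIdx m, ((g⁻¹ : Matrix.GeneralLinearGroup (MatIdx m) ℂ) :
                  Matrix (MatIdx m) (MatIdx m) ℂ) p.1 l •
                    (MvPolynomial.X (l, p.2) : MvPolynomial (MatIdx m × MatIdx m) ℂ)).toLinearMap -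
              weightChar (0 : Weight (MatIdx m)) g •
                (LinearMap.id : MvPolynomial (MatIdx m × MatIdx m) ℂ →ₗ[ℂ] MvPolynomial (MatIdx m × MatIdx m) ℂ))) := by
  simp only [Submodule.mem_inf, Submodule.mem_iInf, LinearMap.mem_ker, LinearMap.sub_apply,
    LinearMap.smul_apply, LinearMap.id_apply, AlgHom.toLinearMap_apply, map_one,
    Submodule.restrictScalars_mem, pow_zero, Ideal.one_eq_top, Submodule.mem_top, sub_self]
  refine ⟨⟨⟨(MvPolynomial.mem_homogeneousSubmodule 0 _).2 (MvPolynomial.isHomogeneous_one _ _),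
    trivial⟩, fun _ _ => trivial⟩, fun g _ => ?_⟩
  have h0 : weightChar (0 : Weight (MatIdx m)) g = 1 := by simp [weightChar]
  rw [h0, one_smul, sub_self]

/-- **Matching floor** (line card §3.2): `D + 1` algebraically independent elements of the seed
truncation `T_U(Dg, t, ν)` give `dim T_U(k Dg, k t, k • ν) ≥ C(k + D, D)` for every `k`
(`stub_gradedFloor` with `S a := T_U(a Dg, a t, a • ν)`, multiplicative by `stub_truncMul`;
`T_U(…) ≤ Hom_{k Dg}` is finite-dimensional).  `ℂ[End W]` being a polynomial ring, the det side
thus inherits every floor the engine certifies from any family it contains. -/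
theorem matching_floor (m : ℕ) (U : Submodule ℂ (MatIdx m → ℂ)) (Dg t : ℕ) (ν : Weight (MatIdx m))
    (D : ℕ) (G : Fin (D + 1) → MvPolynomial (MatIdx m × MatIdx m) ℂ)
    (hG : ∀ i, G i ∈ MvPolynomial.homogeneousSubmodule (MatIdx m × MatIdx m) ℂ Dg ⊓
          ((MvPolynomial.vanishingIdeal ℂ
              {p : MatIdx m × MatIdx m → ℂ | ∀ j : MatIdx m, (fun i => p (j, i)) ∈ U}) ^ t).restrictScalars ℂ ⊓
          (⨅ (M : Matrix (MatIdx m) (MatIdx m) ℂ)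
            (_ : linSubst (MatIdx m) ℂ M (detFormLex ℂ m) = detFormLex ℂ m),
            LinearMap.ker ((MvPolynomial.aeval fun p : MatIdx m × MatIdx m =>
                ∑ l : MatIdx m, M l p.2 •
                  (MvPolynomial.X (p.1, l) : MvPolynomial (MatIdx m × MatIdx m) ℂ)).toLinearMap -
              (LinearMap.id : MvPolynomial (MatIdx m × MatIdx m) ℂ →ₗ[ℂ] MvPolynomial (MatIdx m × MatIdx m) ℂ))) ⊓
          (⨅ (g : Matrix.GeneralLinearGroup (MatIdx m) ℂ) (_ : IsUpperTriangular g),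
            LinearMap.ker ((MvPolynomial.aeval fun p : MatIdx m × MatIdx m =>
                ∑ l : MatIdx m, ((g⁻¹ : Matrix.GeneralLinearGroup (MatIdx m) ℂ) :
                  Matrix (MatIdx m) (MatIdx m) ℂ) p.1 l •
                    (MvPolynomial.X (l, p.2) : MvPolynomial (MatIdx m × MatIdx m) ℂ)).toLinearMap -
              weightChar ν g •
                (LinearMap.id : MvPolynomial (MatIdx m × MatIdx m) ℂ →ₗ[ℂ] MvPolynomial (MatIdx m × MatIdx m) ℂ))))
    (hind : AlgebraicIndependent ℂ G) (k : ℕ) :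
    (k + D).choose D ≤ Module.finrank ℂ ↥(MvPolynomial.homogeneousSubmodule (MatIdx m × MatIdx m) ℂ (k * Dg) ⊓
          ((MvPolynomial.vanishingIdeal ℂ
              {p : MatIdx m × MatIdx m → ℂ | ∀ j : MatIdx m, (fun i => p (j, i)) ∈ U}) ^ (k * t)).restrictScalars ℂ ⊓
          (⨅ (M : Matrix (MatIdx m) (MatIdx m) ℂ)
            (_ : linSubst (MatIdx m) ℂ M (detFormLex ℂ m) = detFormLex ℂ m),
            LinearMap.ker ((MvPolynomial.aeval fun p : MatIdx m × MatIdx m =>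
                ∑ l : MatIdx m, M l p.2 •
                  (MvPolynomial.X (p.1, l) : MvPolynomial (MatIdx m × MatIdx m) ℂ)).toLinearMap -
              (LinearMap.id : MvPolynomial (MatIdx m × MatIdx m) ℂ →ₗ[ℂ] MvPolynomial (MatIdx m × MatIdx m) ℂ))) ⊓
          (⨅ (g : Matrix.GeneralLinearGroup (MatIdx m) ℂ) (_ : IsUpperTriangular g),
            LinearMap.ker ((MvPolynomial.aeval fun p : MatIdx m × MatIdx m =>
                ∑ l : MatIdx m, ((g⁻¹ : Matrix.GeneralLinearGroup (MatIdx m) ℂ) :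
                  Matrix (MatIdx m) (MatIdx m) ℂ) p.1 l •
                    (MvPolynomial.X (l, p.2) : MvPolynomial (MatIdx m × MatIdx m) ℂ)).toLinearMap -
              weightChar (k • ν) g •
                (LinearMap.id : MvPolynomial (MatIdx m × MatIdx m) ℂ →ₗ[ℂ] MvPolynomial (MatIdx m × MatIdx m) ℂ)))) := by
  -- the filtration `a ↦ T_U(a Dg, a t, a • ν)`
  set S : ℕ → Submodule ℂ (MvPolynomial (MatIdx m × MatIdx m) ℂ) := fun a =>
    MvPolynomial.homogeneousSubmodule (MatIdx m × MatIdx m) ℂ (a * Dg) ⊓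
          ((MvPolynomial.vanishingIdeal ℂ
              {p : MatIdx m × MatIdx m → ℂ | ∀ j : MatIdx m, (fun i => p (j, i)) ∈ U}) ^ (a * t)).restrictScalars ℂ ⊓
          (⨅ (M : Matrix (MatIdx m) (MatIdx m) ℂ)
            (_ : linSubst (MatIdx m) ℂ M (detFormLex ℂ m) = detFormLex ℂ m),
            LinearMap.ker ((MvPolynomial.aeval fun p : MatIdx m × MatIdx m =>
                ∑ l : MatIdx m, M l p.2 •
                  (MvPolynomial.X (p.1, l) : MvPolynomial (MatIdx m × MatIdx m) ℂ)).toLinearMap -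
              (LinearMap.id : MvPolynomial (MatIdx m × MatIdx m) ℂ →ₗ[ℂ] MvPolynomial (MatIdx m × MatIdx m) ℂ))) ⊓
          (⨅ (g : Matrix.GeneralLinearGroup (MatIdx m) ℂ) (_ : IsUpperTriangular g),
            LinearMap.ker ((MvPolynomial.aeval fun p : MatIdx m × MatIdx m =>
                ∑ l : MatIdx m, ((g⁻¹ : Matrix.GeneralLinearGroup (MatIdx m) ℂ) :
                  Matrix (MatIdx m) (MatIdx m) ℂ) p.1 l •
                    (MvPolynomial.X (l, p.2) : MvPolynomial (MatIdx m × MatIdx m) ℂ)).toLinearMap -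
              weightChar (a • ν) g •
                (LinearMap.id : MvPolynomial (MatIdx m × MatIdx m) ℂ →ₗ[ℂ] MvPolynomial (MatIdx m × MatIdx m) ℂ)))
    with hS
  have h1 : (1 : MvPolynomial (MatIdx m × MatIdx m) ℂ) ∈ S 0 := by
    have h := one_mem_trunc_zero m U
    simp only [hS, zero_mul, zero_nsmul]
    exact h
  have hmul : ∀ a b : ℕ, S a * S b ≤ S (a + b) := by
    intro a b
    rw [Submodule.mul_le]
    intro x hx y hy
    have h := stub_truncMul m U (a * Dg) (b * Dg) (a * t) (b * t) (a • ν) (b • ν) x y hx hy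
    simp only [hS, add_mul, add_nsmul]
    exact h
  have hG1 : ∀ i, G i ∈ S 1 := fun i => by
    simp only [hS, one_mul, one_nsmul]
    exact hG i
  haveI hfin : FiniteDimensional ℂ ↥(S k) := by
    refine Submodule.finiteDimensional_of_le (?_ : S k ≤
      (MvPolynomial.restrictTotalDegree (MatIdx m × MatIdx m) ℂ (k * Dg)))
    intro x hx
    have hx' : x ∈ MvPolynomial.homogeneousSubmodule (MatIdx m × MatIdx m) ℂ (k * Dg) := hx.1.1.1
    rw [MvPolynomial.mem_restrictTotalDegree]
    rw [MvPolynomial.mem_homogeneousSubmodule] at hx'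
    exact hx'.totalDegree_le
  exact stub_gradedFloor S h1 hmul D G hG1 hind k hfin

/-- **Formal matching — the kill** (line card §3, `deficit_of_census`): a det census
`dim T_U(k Dg, k t, k • ν) < C(k + D, D)` at ANY admissible centre forces EVERY `D + 1` elements of the
seed truncation `T_U(Dg, t, ν)` to be algebraically DEPENDENT in the polynomial ring `ℂ[End W]`.
Since `T_U(mδ₀, δ₀(m - r), ν)` contains the pulled-back Kadish–Landsberg lifts of the per seeds for
every admissible `(U, r)` (the `ValuativeBound` mechanism: `OrbitMapKernel`, `CoeffVanishingOrder`,
both proved), `stub_detCensus` can only hold where those covariants satisfy a relation on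
`End(W_m) · det_m` that fails on `Δ_m(X₀₀^{m-n} per_n)` — already a separating equation, with the
engine idle (line card §3(a)). -/
theorem census_forces_dependence (m : ℕ) (U : Submodule ℂ (MatIdx m → ℂ)) (Dg t : ℕ)
    (ν : Weight (MatIdx m)) (D : ℕ) (G : Fin (D + 1) → MvPolynomial (MatIdx m × MatIdx m) ℂ)
    (hG : ∀ i, G i ∈ MvPolynomial.homogeneousSubmodule (MatIdx m × MatIdx m) ℂ Dg ⊓
          ((MvPolynomial.vanishingIdeal ℂ
              {p : MatIdx m × MatIdx m → ℂ | ∀ j : MatIdx m, (fun i => p (j, i)) ∈ U}) ^ t).restrictScalars ℂ ⊓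
          (⨅ (M : Matrix (MatIdx m) (MatIdx m) ℂ)
            (_ : linSubst (MatIdx m) ℂ M (detFormLex ℂ m) = detFormLex ℂ m),
            LinearMap.ker ((MvPolynomial.aeval fun p : MatIdx m × MatIdx m =>
                ∑ l : MatIdx m, M l p.2 •
                  (MvPolynomial.X (p.1, l) : MvPolynomial (MatIdx m × MatIdx m) ℂ)).toLinearMap -
              (LinearMap.id : MvPolynomial (MatIdx m × MatIdx m) ℂ →ₗ[ℂ] MvPolynomial (MatIdx m × MatIdx m) ℂ))) ⊓
          (⨅ (g : Matrix.GeneralLinearGroup (MatIdx m) ℂ) (_ : IsUpperTriangular g),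
            LinearMap.ker ((MvPolynomial.aeval fun p : MatIdx m × MatIdx m =>
                ∑ l : MatIdx m, ((g⁻¹ : Matrix.GeneralLinearGroup (MatIdx m) ℂ) :
                  Matrix (MatIdx m) (MatIdx m) ℂ) p.1 l •
                    (MvPolynomial.X (l, p.2) : MvPolynomial (MatIdx m × MatIdx m) ℂ)).toLinearMap -
              weightChar ν g •
                (LinearMap.id : MvPolynomial (MatIdx m × MatIdx m) ℂ →ₗ[ℂ] MvPolynomial (MatIdx m × MatIdx m) ℂ))))
    (k : ℕ)
    (hcensus : Module.finrank ℂ ↥(MvPolynomial.homogeneousSubmodule (MatIdx m × MatIdx m) ℂ (k * Dg) ⊓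
          ((MvPolynomial.vanishingIdeal ℂ
              {p : MatIdx m × MatIdx m → ℂ | ∀ j : MatIdx m, (fun i => p (j, i)) ∈ U}) ^ (k * t)).restrictScalars ℂ ⊓
          (⨅ (M : Matrix (MatIdx m) (MatIdx m) ℂ)
            (_ : linSubst (MatIdx m) ℂ M (detFormLex ℂ m) = detFormLex ℂ m),
            LinearMap.ker ((MvPolynomial.aeval fun p : MatIdx m × MatIdx m =>
                ∑ l : MatIdx m, M l p.2 •
                  (MvPolynomial.X (p.1, l) : MvPolynomial (MatIdx m × MatIdx m) ℂ)).toLinearMap -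
              (LinearMap.id : MvPolynomial (MatIdx m × MatIdx m) ℂ →ₗ[ℂ] MvPolynomial (MatIdx m × MatIdx m) ℂ))) ⊓
          (⨅ (g : Matrix.GeneralLinearGroup (MatIdx m) ℂ) (_ : IsUpperTriangular g),
            LinearMap.ker ((MvPolynomial.aeval fun p : MatIdx m × MatIdx m =>
                ∑ l : MatIdx m, ((g⁻¹ : Matrix.GeneralLinearGroup (MatIdx m) ℂ) :
                  Matrix (MatIdx m) (MatIdx m) ℂ) p.1 l •
                    (MvPolynomial.X (l, p.2) : MvPolynomial (MatIdx m × MatIdx m) ℂ)).toLinearMap -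
              weightChar (k • ν) g •
                (LinearMap.id : MvPolynomial (MatIdx m × MatIdx m) ℂ →ₗ[ℂ] MvPolynomial (MatIdx m × MatIdx m) ℂ)))) <
        (k + D).choose D) :
    ¬ AlgebraicIndependent ℂ G := fun hind =>
  absurd (matching_floor m U Dg t ν D G hG hind k) (not_le.2 hcensus)

end

end Summit.ValiantsHypothesis.ValiantsHypothesis.Cruxes.ValuativeFlip.BigCellSemigroupFloor
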